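import Mathlib.Algebra.Central.Defs
import Mathlib.RingTheory.SimpleRing.Basic
import Mathlib.RingTheory.SimpleModule.Basic
import Mathlib.RingTheory.TensorProduct.Basic
import Mathlib.LinearAlgebra.FiniteDimensional.Defs
import Mathlib.LinearAlgebra.Matrix.ToLin
import HarnessLib

/-!
# Kottwitz (1992) §14: the construction of the triple `(γ₀; γ, δ)` from a `c`-polarized virtual `B`-abelian variety
# `(A, λ, i)` over `k_r` — Lemma 14.1 and the printed statements of §14, with the §15 vocabulary `α(γ₀; γ, δ)` they feed
# — as a LETTER: one posited datum, the printed statements as relations over it, nothing asserted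
(R. E. Kottwitz, *Points on some Shimura varieties over finite fields*, J. Amer. Math. Soc. 5 (1992) 373–444, §14
pp. 418–423; the §15 objects of pp. 423–425 that §§16–19 quantify over)

Topic `NumberTheory/Kottwitz1992`; namespace `Literature.NumberTheory.Kottwitz1992.KottwitzTriples`.  STATEMENTS ONLY: one
`structure KottwitzTripleData` (the data §14 quantifies over, every field a bare carrier, map or predicate with its page pin),
`Prop`-valued relations over it (one `def` per printed statement, verbatim numbering), and one closed Mathlib-level named fact
(the «well known» embedding criterion recalled and proved on p. 420).  No theorem, no proof, no `sorry`, no `axiom`, no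
instance, no notation.  ED. 2 (2026-09-02): ED. 1 minus the restated closed fact `Kottwitz1992_14_embeddingsConjugate` (a tree theorem,
see below); every other declaration byte-identical.  Cell hodgecm-mathlib, carpet squad TK (seat TK-t06); the sibling carpets `FixedPointCount` (§16),
`IsogenyClasses` (§17), `TripleImage` (§18), `TotalFixedPoints` (§19) posit the same field names (squad ruling V3, 2026-09-02).
HC_CM is proved only modulo the printed citations until rung 0 closes; nothing here is about HC.

## Source (held text `paper:doi-10-2307-2152772`, file `p00NN` = printed page `372 + NN`; §14 = pp. 418–423, §15 pp. 423–425)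

[§14 p. 418] «Let `p, B, *, F, F₀, 𝒪_B, V, ( , ), C, G, G₁, h, E` be as in §5. However, we now consider only Cases A and C; in fact
Case D will be excluded for the rest of this paper. Let `k, σ, r, k_r, L, L_r` have the same meaning as in §10. Let `c` be a positive
rational number of the form `p^r c₀` where `c₀` is a `p`-adic unit. Let `A = (Ā, u)` be a virtual abelian variety over `k_r` up to
isogeny, let `i : B → End(A)` be a ring homomorphism, and let `λ : A → Â` be a `c`-polarization of the virtual abelian variety `A`
such that `λ ∈ Hom_B(A, Â)`. Thus `(A, λ, i)` is a `c`-polarized virtual `B`-abelian variety over `k_r` up to isogeny. We are going to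
make three assumptions on `(A, λ, i)`. Under these assumptions we will associate to `(A, λ, i)` a triple `(γ₀; γ, δ)` of the type
considered in §2 of [K5].»  FIRST ASSUMPTION (p. 418): «the skew-Hermitian `B`-module `H₁(A, 𝔸_f^p)` be isomorphic to `V ⊗_ℚ 𝔸_f^p`.
Choose an isomorphism … `π_A` can be viewed as an element `π_A ∈ G(𝔸_f^p)`. We take for `γ` the inverse of `π_A`; it is an element of
`G(𝔸_f^p)` whose conjugacy class is independent of the choice of isomorphism».  SECOND ASSUMPTION (p. 419): «the skew-Hermitian
`B`-module `H` be isomorphic to `V ⊗_ℚ L_r` … we then write `Φ = δσ` … `δ ∈ G(L_r)` and changing our choice of isomorphism replaces `δ`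
by a `σ`-conjugate `xδσ(x)⁻¹` (`x ∈ G(L_r)`); in particular, the `σ`-conjugacy class of `δ ∈ G(L_r)` is well defined.»  THIRD
ASSUMPTION (p. 419): «Consider the canonical map `B(G_{ℚ_p}) → X^*(Z(Ĝ)^{Γ(p)})` of §6 of [K5]. Applying this map to the element of
`B(G_{ℚ_p})` represented by `δ`, we get an element of `X^*(Z(Ĝ)^{Γ(p)})`. The third assumption on `(A, λ, i)` is that this element
… be equal to the element `μ₁` constructed from `μ_h` in §2 of [K5].»  (p. 419) `M = End_B(A)` with the (positive) Rosati involution;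
`I = Aut(A, λ, i)`, `I(R) = {x ∈ M_R | xx* ∈ R^×}`; «Let `T` be a maximal torus in `I`. Its centralizer in `M` is a maximal commutative
semisimple subalgebra `N` of `M`; moreover, the involution `*` preserves `N` and `N` is free of rank 2 over its subalgebra
`N₀ := {x ∈ N | x* = x}`».  (p. 420) «`N` … has the same dimension over `F` as the maximal commutative semisimple subalgebras of
`C = End_B(V)`, namely, `(dim_F C)^{1/2}`. Since `dim_F(N) = (dim_F C)^{1/2}`, there exists an `F`-algebra embedding `N → C` if and
only if `N ⊗_F C` is a matrix algebra over `N`, and any two such embeddings are conjugate under `C^×`. This statement is well known,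
but we will recall its proof … We have now shown that there exists an `F`-algebra embedding `i : N → C`, unique up to conjugacy under
`C^×`.»  **LEMMA 14.1** (p. 420): «There exists an `F`-algebra embedding `i : N → C` that is a `*`-homomorphism.»  (p. 422) «Choose a
`*`-homomorphism `i : N → C` (as in the lemma). … `π_A` gives an element `π_A ∈ T(ℚ)`. We first define an element `γ₀ ∈ T(ℚ)` by taking
the inverse of `π_A`. Then, using the `*`-homomorphism `N → C` to embed `T` in `G` over `ℚ`, we regard `γ₀` as an element of `G(ℚ)`.
Of course `γ₀ ∈ G(ℚ)` depends on the choice of embedding `i`, but since any two such embedding are conjugate under `G(ℚ̄)`, the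
stable conjugacy class of `γ₀` is well defined. … It is clear that `γ₀` is semisimple and that it is elliptic in `G(ℝ)`. … both `γ_l`
and `γ₀` have image `c⁻¹` under the usual homomorphism `G → 𝔾_m` … we are now finished verifying that `(γ₀; γ, δ)` satisfies all the
conditions of §2 of [K5].»  (pp. 422–423) «We have the `ℚ`-group `I` (automorphisms of the triple `(A, λ, i)`) and another `ℚ`-group
`I₀ := G_{γ₀}` … inducing an inner twisting `ψ : I₀ → I` over `ℚ̄` … It follows that the group `I` of this paper can serve as the
group `I` used in §3 of [K5].»  [§15 p. 423] «there is a construction of an element `α(γ₀; γ, δ) ∈ 𝔎(I₀/ℚ)^D`, where `I₀` denotes the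
centralizer of `γ₀` in `G` … `𝔎(I₀/ℚ)` is the subgroup of `π₀((Z(Î₀)/Z(Ĝ))^Γ)` consisting of elements whose image in `H¹(ℚ, Z(Ĝ))`
lies in `ker¹(ℚ, Z(Ĝ))`».  The §15 statements (Lemmas 15.1, 15.2) are typed in the sibling carpet `AlphaVanishing`.

## What is typed, and how

* `KottwitzTripleData` — ONE posited datum (universe `u`): the rational points `G(ℚ)`, `G(𝔸_f^p)`, `G(L_r)` as bare carriers with the
  three conjugacy relations the print uses (conjugacy, `σ`-conjugacy, stable conjugacy), the multiplier `G → 𝔾_m` on `G(ℚ)`, the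
  objects `(A, λ, i)` (`Obj`), the CHOICES the construction depends on as types (`Iso1 X`, `Iso2 X` — the two assumed isomorphisms;
  `MaxTorus X`, `Emb X T` — the torus `T ⊂ I` and the `F`-algebra embeddings `N → C`), the three assumptions and every printed
  predicate (`KappaIsMuOne`, `IsStarHom`, `K5Conditions`, `IsInnerTwist`, `LadicMatch`, semisimple, elliptic) as `Prop`-valued
  fields, the constructions `γ = gammaOf`, `δ = deltaOf`, `γ₀ = gamma0Of` as maps out of the choices, and the §15 targets
  `𝔎(I₀/ℚ)^D` (`KD γ₀`, identity `kdOne`), `α(γ₀; γ, δ)` (`alpha`), `X^*(Z(Î₀)^Γ)` (`XZ γ₀`, `xzOne`), `α(γ₀; A, λ, i)` (`alphaObj`)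
  and the map `𝔎(I₀/ℚ)^D → X^*(Z(Î₀)^Γ)` (`inflate`).  Nothing in the structure asserts a printed statement (squad ruling V1).
* RELATIONS over the datum, one per printed statement: `Assump1 ∕ Assump2 ∕ Assump3 ∕ Assumptions`, `GammaWellDefined` (p. 418),
  `DeltaWellDefined`, `KappaRespectsSigmaConj` (p. 419), `EmbExists` (p. 420), **`Kottwitz1992_14_1_existsStarEmbedding`** (Lemma
  14.1), `Gamma0WellDefined`, `Gamma0Basic`, `TripleSatisfiesK5` (p. 422), `InnerTwist14` (pp. 422–423), `WeakHyp` (the weaker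
  assumption of p. 423), and the conjunction `PrintedLaws14`.
* CLOSED NAMED FACT at Mathlib level (the «well known» statement of p. 420, proof recalled there): **`Kottwitz1992_14_embeddingCriterion`**
  (a commutative semisimple `N` with `[N:F]² = [C:F]` embeds in the central simple `C` iff `N ⊗_F C ≅ M_{[N:F]}(N)` as `N`-algebras; the
  tree proves both directions for `N` a FIELD — ★ `Literature.RingTheory.CentralSimple.nonempty_algEquiv_baseChange_matrix_of_sq_eq`,
  ★ `nonempty_algHom_of_algEquiv_baseChange_matrix` (Bourbaki VIII §15 n°3 Cor. 1) — Kottwitz needs the commutative SEMISIMPLE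
  `N = Cent_M(T)`, a product of CM fields).  The second half of the printed sentence, «any two such embeddings are conjugate under `C^×`»,
  IS the tree's theorem ★ `Literature.RingTheory.CentralSimple.exists_units_forall_algHom_eq_conj_of_isSemisimpleRing` (Bourbaki VIII §14
  n°6 Corollaire; file `SkolemNoetherCommutativeSemisimple.lean`) and is CITED BY NAME, not restated (ED. 2: the ED. 1 restatement
  `Kottwitz1992_14_embeddingsConjugate`, referenced by nothing, is withdrawn — squad dedup rule 2026-09-02).
NOT typed here: the PEL datum of §5 and the group `G` as a scheme (carpet `ModuliProblem`), virtual abelian varieties and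
`c`-polarizations (§10, carpet `VirtualAbelianVarieties`), isocrystals and `B(G)` (§11, carpet `Isocrystals`; Mathlib
`WittVector.Isocrystal`), the conditions of §2 of [K5] = Kottwitz 1990 (posited as ONE predicate `K5Conditions`), the PROOF of Lemma
14.1 (Hermitian forms, transfer of the torus `T₀` to the inner form, `ker²(F₀, U) = 0`, pp. 420–422), and Lemmas 15.1–15.2.

References: [Kottwitz1992] R. E. Kottwitz, JAMS 5 (1992), §5 p. 389, §10 pp. 402–403, §14 pp. 418–423 (Lemma 14.1 p. 420), §15
pp. 423–425.  [K5] of the source = R. E. Kottwitz, *Shimura varieties and λ-adic representations* (1990), §§2, 3, 6 — cited by the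
source, not restated.
-/

open scoped TensorProduct

namespace Literature.NumberTheory.Kottwitz1992.KottwitzTriples

universe u

/-! ## §1 The «well known» embedding criterion of p. 420 (Mathlib level, closed named facts) -/

/-- **«Since `dim_F(N) = (dim_F C)^{1/2}`, there exists an `F`-algebra embedding `N → C` if and only if `N ⊗_F C` is a matrix algebra
over `N`»** — for a field `F`, a finite-dimensional central simple `F`-algebra `C` and a finite-dimensional commutative semisimple
`F`-algebra `N` with `[N : F]² = [C : F]`: an injective `F`-algebra homomorphism `N → C` exists iff `N ⊗_F C` is isomorphic, as an
`N`-algebra, to the matrix algebra `M_{[N:F]}(N)` (the print's «matrix algebra over `N`»: `dim_N (N ⊗_F C) = [C : F] = [N : F]²`).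
The source recalls the proof (via `C ⊗_F N`-module structures on `C`, p. 420). [cite: Kottwitz1992, §14 (p. 420)] -/
def Kottwitz1992_14_embeddingCriterion : Prop :=
  ∀ (F : Type u) [Field F] (C : Type u) [Ring C] [Algebra F C] [Algebra.IsCentral F C] [IsSimpleRing C]
    [FiniteDimensional F C] (N : Type u) [CommRing N] [Algebra F N] [IsSemisimpleRing N] [FiniteDimensional F N],
    Module.finrank F N ^ 2 = Module.finrank F C →
      ((∃ f : N →ₐ[F] C, Function.Injective f) ↔
        Nonempty ((N ⊗[F] C) ≃ₐ[N] Matrix (Fin (Module.finrank F N)) (Fin (Module.finrank F N)) N))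

-- «… and any two such embeddings are conjugate under `C^×`» (p. 420) is the tree's theorem
-- `Literature.RingTheory.CentralSimple.exists_units_forall_algHom_eq_conj_of_isSemisimpleRing` (same hypotheses: `C` central simple of
-- finite degree over `F`, `N` commutative semisimple, `finrank F N ^ 2 = finrank F C`, `f g : N →ₐ[F] C` injective ⊢ `∃ u : Cˣ, ∀ a,
-- g a = u * f a * ↑u⁻¹`) — cited by name, not restated.  [cite: Kottwitz1992, §14 (p. 420)]

/-! ## §2 The posited datum of §14 (and the §15 targets the later sections quantify over) -/

/-- **The data of Kottwitz's §14 AS A DATUM.**  Fixed behind it (not fields): the PEL datum `p, B, *, F, F₀, 𝒪_B, V, ( , ), C = End_B(V),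
G, G₁, h, E` of §5 (p. 389) in Case A or C, and `k = 𝔽̄_p`, `σ`, `r`, `k_r` (the field with `p^r` elements), `L = Frac W(k)`, `L_r =
Frac W(k_r)` of §10 (pp. 402–403).  Fields: the prime `p`, the integer `r` and the positive rational `c = p^r c₀` (p. 418); the rational
points `G(ℚ)`, `G(𝔸_f^p)`, `G(L_r)` as bare carriers with conjugacy, `σ`-conjugacy and stable conjugacy as relations and the multiplier
`G → 𝔾_m` on `G(ℚ)`; the objects `(A, λ, i)` = `c`-polarized virtual `B`-abelian varieties over `k_r` up to isogeny (`Obj`); for each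
object the two sets of isomorphisms whose non-emptiness are the first two assumptions (`Iso1`, `Iso2`) with the transported Frobenius data
`γ` (`gammaOf`) and `δ` (`deltaOf`); the third assumption as a predicate on `δ` (`KappaIsMuOne`); the maximal tori `T ⊂ I = Aut(A, λ, i)`
(`MaxTorus`), the `F`-algebra embeddings `N = Cent_M(T) → C` (`Emb`) with «is a `*`-homomorphism» (`IsStarHom`) and the resulting
`γ₀ ∈ G(ℚ)` (`gamma0Of`); the predicates «`(γ₀; γ, δ)` satisfies the conditions of §2 of [K5]» (`K5Conditions`), «`I` is an inner twist
of `G_{γ₀}`» (`IsInnerTwist`), «`V_l ≅ H_l` as `B ⊗ ℚ_l[T]`-modules for all `l ≠ p`» (`LadicMatch`), semisimple, elliptic in `G(ℝ)`; and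
the §15 targets `𝔎(I₀/ℚ)^D ∋ α(γ₀; γ, δ)`, `X^*(Z(Î₀)^Γ) ∋ α(γ₀; A, λ, i)` with their identity elements and the map between them.  No
field asserts a printed statement; those are the relations below. [cite: Kottwitz1992, §14 (pp. 418–423)] -/
structure KottwitzTripleData : Type (u + 1) where
  /-- the rational prime `p` (good reduction, §5) [§5 p. 389; §14 p. 418] -/
  p : ℕ
  /-- the positive integer `r`: `k_r` is the field with `p^r` elements, `L_r = Frac W(k_r)` [§10 pp. 402–403; §14 p. 418] -/
  r : ℕ
  /-- the positive rational number `c = p^r c₀`, `c₀` a `p`-adic unit; the objects are `c`-polarized [§14 p. 418] -/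
  c : ℚ
  /-- `G(ℚ)`, `G = {x ∈ C ⊗ R | x x* ∈ R^×}`, `C = End_B(V)` [§5 p. 389] -/
  GQ : Type u
  /-- `G(𝔸_f^p)`, `𝔸_f^p` the finite adeles of `ℚ` with trivial `p`-adic component [§5 p. 389; §14 p. 418] -/
  GAfp : Type u
  /-- `G(L_r)` [§14 p. 419] -/
  GLr : Type u
  /-- the multiplier `x ↦ x x*`, «the usual homomorphism `G → 𝔾_m`», on `G(ℚ)` [§5 p. 389; §14 p. 422] -/
  simil : GQ → ℚ
  /-- conjugacy under `G(𝔸_f^p)` [§14 p. 418] -/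
  IsConjAfp : GAfp → GAfp → Prop
  /-- `σ`-conjugacy in `G(L_r)`: `δ' = x δ σ(x)⁻¹` for some `x ∈ G(L_r)` [§14 p. 419] -/
  IsSigmaConj : GLr → GLr → Prop
  /-- stable conjugacy in `G(ℚ)` (conjugate under `G(ℚ̄)`) [§14 p. 422] -/
  IsStConj : GQ → GQ → Prop
  /-- «`γ₀` is semisimple» [§14 p. 422; §15 p. 423] -/
  IsSemisimple : GQ → Prop
  /-- «`γ₀` is elliptic in `G(ℝ)`» [§14 p. 422; §15 p. 423] -/
  IsEllipticR : GQ → Prop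
  /-- the objects: `c`-polarized virtual `B`-abelian varieties `(A, λ, i)` over `k_r` up to isogeny [§10 p. 403; §14 p. 418] -/
  Obj : Type u
  /-- the isomorphisms `H₁(A, 𝔸_f^p) ≅ V ⊗_ℚ 𝔸_f^p` of skew-Hermitian `B`-modules (FIRST assumption: non-empty) [§14 p. 418] -/
  Iso1 : Obj → Type u
  /-- `γ ∈ G(𝔸_f^p)`: the inverse of the Frobenius element `π_A` of `A`, transported by the chosen isomorphism [§14 p. 418] -/
  gammaOf : (X : Obj) → Iso1 X → GAfp
  /-- the isomorphisms `H ≅ V ⊗_ℚ L_r` of skew-Hermitian `B`-modules, `(H, Φ)` the isocrystal of `A` over `L_r` (SECOND assumption: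
  non-empty) [§14 p. 419] -/
  Iso2 : Obj → Type u
  /-- `δ ∈ G(L_r)` with `Φ = δσ` after transport by the chosen isomorphism [§14 p. 419] -/
  deltaOf : (X : Obj) → Iso2 X → GLr
  /-- THIRD assumption, as a predicate on `δ`: the image of `[δ] ∈ B(G_{ℚ_p})` under `B(G_{ℚ_p}) → X^*(Z(Ĝ)^{Γ(p)})` (§6 of [K5])
  equals `μ₁` (from `μ_h`, §2 of [K5]) [§14 p. 419] -/
  KappaIsMuOne : GLr → Prop
  /-- the maximal tori `T` of `I = Aut(A, λ, i)`, `I(R) = {x ∈ M_R | x x* ∈ R^×}`, `M = End_B(A)` [§14 p. 419] -/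
  MaxTorus : Obj → Type u
  /-- the `F`-algebra embeddings `i : N → C`, `N = Cent_M(T)` [§14 p. 420] -/
  Emb : (X : Obj) → MaxTorus X → Type u
  /-- «`i` is a `*`-homomorphism» (Rosati involution on `N`, the involution of `( , )` on `C`) [§14 Lemma 14.1 p. 420] -/
  IsStarHom : {X : Obj} → {T : MaxTorus X} → Emb X T → Prop
  /-- `γ₀ ∈ G(ℚ)`: the inverse of `π_A ∈ T(ℚ)` regarded in `G(ℚ)` through `T ↪ G` induced by `i : N → C` [§14 p. 422] -/
  gamma0Of : (X : Obj) → (T : MaxTorus X) → Emb X T → GQ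
  /-- «all the conditions imposed in §2 of [K5]» on a triple `(γ₀; γ, δ) ∈ G(ℚ) × G(𝔸_f^p) × G(L_r)` (Kottwitz 1990 §2; not restated)
  [§14 pp. 418, 422] -/
  K5Conditions : GQ → GAfp → GLr → Prop
  /-- «`I = Aut(A, λ, i)` is an inner twist of `I₀ = G_{γ₀}`» (an inner twisting `ψ : I₀ → I` over `ℚ̄`, canonical up to inner
  automorphisms of `I₀`) [§14 pp. 422–423; §15 p. 424] -/
  IsInnerTwist : Obj → GQ → Prop
  /-- «for every prime `l` different from `p` the `B ⊗_ℚ ℚ_l[T]`-modules `V_l := V ⊗_ℚ ℚ_l` and `H_l := H₁(A, ℚ_l)` are isomorphic, where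
  `T` acts on `V_l` by `γ₀⁻¹` and on `H_l` by `π_A`» [§15 p. 423] -/
  LadicMatch : Obj → GQ → Prop
  /-- `𝔎(I₀/ℚ)^D`, the Pontryagin dual of `𝔎(I₀/ℚ) ⊂ π₀((Z(Î₀)/Z(Ĝ))^Γ)`, `I₀ = G_{γ₀}` [§15 p. 423] -/
  KD : GQ → Type u
  /-- the trivial element of `𝔎(I₀/ℚ)^D` [§15 p. 423] -/
  kdOne : (γ₀ : GQ) → KD γ₀
  /-- `α(γ₀; γ, δ) ∈ 𝔎(I₀/ℚ)^D` (constructed in §2 of [K5]) [§15 p. 423] -/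
  alpha : (γ₀ : GQ) → GAfp → GLr → KD γ₀
  /-- `X^*(Z(Î₀)^Γ)`, `Γ = Gal(ℚ̄/ℚ)` [§15 p. 424] -/
  XZ : GQ → Type u
  /-- the trivial character of `Z(Î₀)^Γ` [§15 p. 424] -/
  xzOne : (γ₀ : GQ) → XZ γ₀
  /-- `α(γ₀; A, λ, i) ∈ X^*(Z(Î₀)^Γ)`: the product over all places of `ℚ` of the restrictions of the local characters `α_v`
  [§15 p. 424] -/
  alphaObj : (γ₀ : GQ) → Obj → XZ γ₀
  /-- the map `𝔎(I₀/ℚ)^D → X^*(Z(Î₀)^Γ)` dual to the natural map `Z(Î₀)^Γ → 𝔎(I₀/ℚ)` («we use the surjection `Z(Î₀)^Γ → 𝔎(I₀/ℚ)` to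
  view `α(γ₀; γ, δ)` as an element of `X^*(Z(Î₀)^Γ)`») [§15 p. 425] -/
  inflate : (γ₀ : GQ) → KD γ₀ → XZ γ₀

namespace KottwitzTripleData

variable (D : KottwitzTripleData.{u})

/-! ## §3 The three assumptions of §14 (pp. 418–419) -/

/-- **FIRST ASSUMPTION**: «the skew-Hermitian `B`-module `H₁(A, 𝔸_f^p)` be isomorphic to `V ⊗_ℚ 𝔸_f^p`». [cite: Kottwitz1992, §14 (p. 418)] -/
def Assump1 (X : D.Obj) : Prop :=
  Nonempty (D.Iso1 X)

/-- **SECOND ASSUMPTION**: «the skew-Hermitian `B`-module `H` be isomorphic to `V ⊗_ℚ L_r`». [cite: Kottwitz1992, §14 (p. 419)] -/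
def Assump2 (X : D.Obj) : Prop :=
  Nonempty (D.Iso2 X)

/-- **THIRD ASSUMPTION**: the image of `[δ] ∈ B(G_{ℚ_p})` in `X^*(Z(Ĝ)^{Γ(p)})` equals `μ₁` — for the `δ` obtained from every choice of
isomorphism (the `σ`-conjugacy class of `δ`, hence `[δ]`, does not depend on the choice, p. 419). [cite: Kottwitz1992, §14 (p. 419)] -/
def Assump3 (X : D.Obj) : Prop :=
  ∀ e : D.Iso2 X, D.KappaIsMuOne (D.deltaOf X e)

/-- «the three assumptions of §14» on `(A, λ, i)`. [cite: Kottwitz1992, §14 (pp. 418–419)] -/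
def Assumptions (X : D.Obj) : Prop :=
  D.Assump1 X ∧ D.Assump2 X ∧ D.Assump3 X

/-! ## §4 The printed statements of §14 as relations over the datum -/

/-- **«`γ` … is an element of `G(𝔸_f^p)` whose conjugacy class is independent of the choice of isomorphism between `H₁(A, 𝔸_f^p)` and
`V ⊗_ℚ 𝔸_f^p`»**, AS A RELATION. [cite: Kottwitz1992, §14 (p. 418)] -/
def GammaWellDefined : Prop :=
  ∀ (X : D.Obj) (e e' : D.Iso1 X), D.IsConjAfp (D.gammaOf X e) (D.gammaOf X e')

/-- **«changing our choice of isomorphism replaces `δ` by a `σ`-conjugate `xδσ(x)⁻¹` (`x ∈ G(L_r)`); in particular, the `σ`-conjugacy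
class of `δ ∈ G(L_r)` is well defined»**, AS A RELATION. [cite: Kottwitz1992, §14 (p. 419)] -/
def DeltaWellDefined : Prop :=
  ∀ (X : D.Obj) (e e' : D.Iso2 X), D.IsSigmaConj (D.deltaOf X e) (D.deltaOf X e')

/-- The third assumption is a condition on «the element of `B(G_{ℚ_p})` represented by `δ`»: `σ`-conjugate elements give the same
answer, AS A RELATION. [cite: Kottwitz1992, §14 (p. 419)] -/
def KappaRespectsSigmaConj : Prop :=
  ∀ δ δ' : D.GLr, D.IsSigmaConj δ δ' → (D.KappaIsMuOne δ ↔ D.KappaIsMuOne δ')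

/-- **«We have now shown that there exists an `F`-algebra embedding `i : N → C`, unique up to conjugacy under `C^×`»** (existence half;
for `(A, λ, i)` under the assumptions of §14 and any maximal torus `T` of `I`), AS A RELATION. [cite: Kottwitz1992, §14 (p. 420)] -/
def EmbExists : Prop :=
  ∀ X : D.Obj, D.Assumptions X → ∀ T : D.MaxTorus X, Nonempty (D.Emb X T)

/-- **LEMMA 14.1**: «There exists an `F`-algebra embedding `i : N → C` that is a `*`-homomorphism.» — for `(A, λ, i)` under the three
assumptions of §14, `T` a maximal torus of `I = Aut(A, λ, i)`, `N = Cent_M(T)`; AS A RELATION over the datum (the printed proof, pp.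
420–422, uses the `l`-adic isomorphisms of the first assumption, the splitting of `B` at `p` (§5) and the positivity of `*` on `N`).
[cite: Kottwitz1992, Lemma 14.1 (p. 420)] -/
def Kottwitz1992_14_1_existsStarEmbedding : Prop :=
  ∀ X : D.Obj, D.Assumptions X → ∀ T : D.MaxTorus X, ∃ e : D.Emb X T, D.IsStarHom e

/-- **«Of course `γ₀ ∈ G(ℚ)` depends on the choice of embedding `i`, but since any two such embedding are conjugate under `G(ℚ̄)`, the
stable conjugacy class of `γ₀` is well defined»** (for a fixed maximal torus `T`), AS A RELATION. [cite: Kottwitz1992, §14 (p. 422)] -/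
def Gamma0WellDefined : Prop :=
  ∀ X : D.Obj, D.Assumptions X → ∀ (T : D.MaxTorus X) (e e' : D.Emb X T),
    D.IsStarHom e → D.IsStarHom e' → D.IsStConj (D.gamma0Of X T e) (D.gamma0Of X T e')

/-- **«It is clear that `γ₀` is semisimple and that it is elliptic in `G(ℝ)`. … both `γ_l` and `γ₀` have image `c⁻¹` under the usual
homomorphism `G → 𝔾_m`»**, AS A RELATION. [cite: Kottwitz1992, §14 (p. 422)] -/
def Gamma0Basic : Prop :=
  ∀ X : D.Obj, D.Assumptions X → ∀ (T : D.MaxTorus X) (e : D.Emb X T), D.IsStarHom e →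
    D.IsSemisimple (D.gamma0Of X T e) ∧ D.IsEllipticR (D.gamma0Of X T e) ∧ D.simil (D.gamma0Of X T e) = D.c⁻¹

/-- **«We finally have the desired triple `(γ₀; γ, δ)` … we are now finished verifying that `(γ₀; γ, δ)` satisfies all the conditions
of §2 of [K5]»** (among them: `γ₀` is `G(ℚ̄_l)`-conjugate to the `l`-adic component `γ_l` of `γ` for all `l ≠ p`, and `Nδ` is
conjugate to `γ₀`), AS A RELATION — for every choice of the two isomorphisms and of the `*`-embedding. [cite: Kottwitz1992, §14 (p. 422)] -/
def TripleSatisfiesK5 : Prop :=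
  ∀ X : D.Obj, D.Assumptions X → ∀ (T : D.MaxTorus X) (e : D.Emb X T), D.IsStarHom e →
    ∀ (e₁ : D.Iso1 X) (e₂ : D.Iso2 X), D.K5Conditions (D.gamma0Of X T e) (D.gammaOf X e₁) (D.deltaOf X e₂)

/-- **«… a `ℚ̄`-valued point `ψ ∈ Ψ(ℚ̄)`, inducing an inner twisting `ψ : I₀ → I` over `ℚ̄` … It follows that the group `I` of this paper
can serve as the group `I` used in §3 of [K5]»**: `I = Aut(A, λ, i)` is an inner twist of `I₀ = G_{γ₀}`, AS A RELATION.
[cite: Kottwitz1992, §14 (pp. 422–423)] -/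
def InnerTwist14 : Prop :=
  ∀ X : D.Obj, D.Assumptions X → ∀ (T : D.MaxTorus X) (e : D.Emb X T), D.IsStarHom e → D.IsInnerTwist X (D.gamma0Of X T e)

/-- **The weaker assumption of §15** on `(A, λ, i)` and an element `γ₀ ∈ G(ℚ)`: «there exists a semisimple element `γ₀ ∈ G(ℚ)`, elliptic
in `G(ℝ)`, with `γ₀γ₀* = c⁻¹`, and such that for every prime `l` different from `p` the `B ⊗_ℚ ℚ_l[T]`-modules `V_l` and `H_l` are
isomorphic» (standing hypothesis of Lemma 15.2). [cite: Kottwitz1992, §15 (pp. 423–424)] -/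
def WeakHyp (X : D.Obj) (γ₀ : D.GQ) : Prop :=
  D.IsSemisimple γ₀ ∧ D.IsEllipticR γ₀ ∧ D.simil γ₀ = D.c⁻¹ ∧ D.LadicMatch X γ₀

/-- The conjunction of the §14 relations above (what a consumer of the construction `(A, λ, i) ↦ (γ₀; γ, δ)` takes as ONE hypothesis).
[cite: Kottwitz1992, §14 (pp. 418–423)] -/
def PrintedLaws14 : Prop :=
  D.GammaWellDefined ∧ D.DeltaWellDefined ∧ D.KappaRespectsSigmaConj ∧ D.EmbExists ∧
    D.Kottwitz1992_14_1_existsStarEmbedding ∧ D.Gamma0WellDefined ∧ D.Gamma0Basic ∧ D.TripleSatisfiesK5 ∧ D.InnerTwist14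

end KottwitzTripleData

end Literature.NumberTheory.Kottwitz1992.KottwitzTriples
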